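import Mathlib
import HarnessLib
import Summits.HubbardSuperconductivity.HubbardSuperconductivity.Theorems.KLProgrammeKLRegimeThinOverlapIncrementRows
import Summits.HubbardSuperconductivity.HubbardSuperconductivity.Theorems.KLProgrammeKLRegimeSectorSliceSectionalRows

/-!
# K3 VL child `KLRegimeVolumeLimitV17F2` (stmt-HubbardSuperconductivity-20440), located item #23 «W2-HALF-VL», brick «W2H-OVL» part 15 (ROWS, `Λ_T`-currency):
# the `(1 + Λ_T·tnorm)`-weighted ROWS and COLUMNS of the re-analysis increment `klReanalysis[K′] k − klReanalysis[K] k` from a uniform bound on the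
# thin-pair frame-difference character sums at ANY rates `(s₀, s₁)` with `Λ_T ≤ D_w·s₁`

Cell `gate-hubbard-kl`, seat p3 (g15), lead of #23.  `TransferWtData` (the spine's transfer bundle, `…TwoVolumeSpineDataDefs`) reads rows and columns in the
SPATIAL currency `1 + Λ_T·tnorm(x⃗″ − x⃗′)` at a free rate `Λ_T ≥ 0`; the part-6 rows (`rowSumWt_klReanalysis_sub_le`, tree weight `klScaleWt (k+1)`, rate
`Λ_{k+1}` in space AND `Λ_{k+1}β/2M` in time) are stronger than needed and force the weight-domination constant `D_w ≍ Λ_{k+1}·x/ρ` on a piece at depth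
`x` — which makes the per-piece telescope bound `x`-free instead of `∝ 1/x` (located note «W2H-OVL-CURRENCY», KL STATUS 2026-08-28).  Here the same
block layer (k3c4-p2 `rowSum_wt_overlapKernel_sub_le`, any weight) is run directly in the `Λ_T`-currency:

* `tnorm_neg_eq` — `tnorm(−u) = tnorm u`;
* `rowSumTn_overlapKernel_sub_le`, `colSumTn_overlapKernel_sub_le` — one defect block: `≤ (βV²)⁻¹·Σ_z (1 + Λ_T·tnorm z⃗₂)‖S^Δ(z)‖`;
* `charSumW_klAniso_bgmFat_sub_le` — thin × fat difference `≤ 3T` from thin × thin differences `≤ T`, ANY nonnegative weight;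
* **`rowSumTn_klReanalysis_sub_le_of_rates`**, **`colSumTn_klReanalysis_sub_le_of_rates`** — if the thin-pair frame differences are `≤ T` in the rate
  currency `1 + s₀|z̃₁| + s₁(|z̃₂⁰| + |z̃₂¹|)` (`s₀ ≥ 0`) and `1 ≤ D_w`, `0 ≤ Λ_T ≤ D_w·s₁`, then every `(1 + Λ_T·tnorm)`-weighted row of the increment is
  `≤ ε·((27+27)·(3(D_w T)/(βV²)))` and every column `≤ ε·((54+54)·(3(D_w T)/(βV²)))` (`ε = imagTimeWeight β M`).

With `s₁ = ρ/x` and `Λ_T ≤ ρ/x_max` one has `D_w = 1` on every piece of the chain.  Everything is proved; no definitions, no sorry.  Nothing asserts any stub,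
K3, VL or superconductivity. [cite: BenfattoGiulianiMastropietro2006, §2.7 (2.66), (2.71)–(2.71a), §3 (3.3)]
-/

noncomputable section

namespace Summit.HubbardSuperconductivity.HubbardSuperconductivity.Theorems.TorusFourierL2

set_option linter.dupNamespace false -- summit = problem name (single-conjunct summit), D-0017

open Finset Complex Literature.MathematicalPhysics.QuantumLattice Literature.Probability.LatticeModels
open Summit.HubbardSuperconductivity.HubbardSuperconductivity.Theorems.KLProgrammeLegKernels
open Summit.HubbardSuperconductivity.HubbardSuperconductivity.Theorems.KLRegimeSplit
open Summit.HubbardSuperconductivity.HubbardSuperconductivity.Theorems.EngineV8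
open Summit.HubbardSuperconductivity.HubbardSuperconductivity.Theorems.PerturbedFermiCurve
open Summit.HubbardSuperconductivity.HubbardSuperconductivity.Theorems.TwoVolumeSource
open scoped Real ComplexConjugate

open Classical

variable {L M : ℕ} [NeZero L] [NeZero M] {N N' : ℕ}

omit [NeZero M] in
/-- `tnorm(−u) = tnorm u` on the discrete torus. [folklore] -/
theorem tnorm_neg_eq {d : ℕ} (u : TorusSite d L) : Torus.tnorm (-u) = Torus.tnorm u :=
  le_antisymm (Torus.tnorm_neg_le u) (by simpa using Torus.tnorm_neg_le (-u))

/-! ### §1 One defect block in the `Λ_T`-currency -/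

/-- **`(1 + Λ_T·tnorm)`-weighted row position sum of one defect kernel** `≤ (βL²)⁻¹·Σ_z (1 + Λ_T·tnorm z⃗₂)‖S^Δ(z)‖` (in fact an equality; any real `Λ_T`).
[cite: BenfattoGiulianiMastropietro2006, §2.7 (2.71a)] -/
theorem rowSumTn_overlapKernel_sub_le {β : ℝ} (hβ : 0 < β) (F'₁ F'₂ : Fin N' → FreqMomentum L M → ℂ) (F₁ F₂ : Fin N → FreqMomentum L M → ℂ)
    (ΛT : ℝ) (ω' : Fin N') (ω : Fin N) (σ c : Fin 2) (y : SpaceTimeIdx L M) :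
    ∑ x : SpaceTimeIdx L M, ‖(sectorAnalysisMatrix L M β F'₁ * sectorSubMatrix L M β F₁ -
        sectorAnalysisMatrix L M β F'₂ * sectorSubMatrix L M β F₂) (y, ((ω', σ), c)) (x, ((ω, σ), c))‖ *
        (1 + ΛT * (Torus.tnorm (y.2 - x.2) : ℝ)) ≤
      1 / (β * (L : ℝ) ^ 2) * ∑ z : TorusSite 1 (2 * M) × TorusSite 2 L,
        (1 + ΛT * (Torus.tnorm z.2 : ℝ)) *
          ‖∑ q : TorusSite 1 (2 * M) × TorusSite 2 L, (torusChar q.1 z.1 * torusChar q.2 z.2) •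
            (F'₁ ω' (⟨(q.1 0).val, ZMod.val_lt (q.1 0)⟩, q.2) * F₁ ω (⟨(q.1 0).val, ZMod.val_lt (q.1 0)⟩, q.2) -
              F'₂ ω' (⟨(q.1 0).val, ZMod.val_lt (q.1 0)⟩, q.2) * F₂ ω (⟨(q.1 0).val, ZMod.val_lt (q.1 0)⟩, q.2))‖ := by
  have hL : (0 : ℝ) < L := Nat.cast_pos.2 (Nat.pos_of_ne_zero (NeZero.ne L))
  have hc0 : 0 ≤ 1 / (β * (L : ℝ) ^ 2) := by positivity
  set h : TorusSite 1 (2 * M) × TorusSite 2 L → ℝ := fun z =>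
    (1 + ΛT * (Torus.tnorm z.2 : ℝ)) *
      ‖∑ q : TorusSite 1 (2 * M) × TorusSite 2 L, (torusChar q.1 z.1 * torusChar q.2 z.2) •
        (F'₁ ω' (⟨(q.1 0).val, ZMod.val_lt (q.1 0)⟩, q.2) * F₁ ω (⟨(q.1 0).val, ZMod.val_lt (q.1 0)⟩, q.2) -
          F'₂ ω' (⟨(q.1 0).val, ZMod.val_lt (q.1 0)⟩, q.2) * F₂ ω (⟨(q.1 0).val, ZMod.val_lt (q.1 0)⟩, q.2))‖ with hh
  have hpt : ∀ x : SpaceTimeIdx L M,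
      ‖(sectorAnalysisMatrix L M β F'₁ * sectorSubMatrix L M β F₁ - sectorAnalysisMatrix L M β F'₂ * sectorSubMatrix L M β F₂)
          (y, ((ω', σ), c)) (x, ((ω, σ), c))‖ * (1 + ΛT * (Torus.tnorm (y.2 - x.2) : ℝ)) =
        1 / (β * (L : ℝ) ^ 2) *
          h ((fun _ : Fin 1 => (((if c = 0 then x else y).1 : ℕ) : ZMod (2 * M)) - (((if c = 0 then y else x).1 : ℕ) : ZMod (2 * M))),
            (if c = 0 then x else y).2 - (if c = 0 then y else x).2) := by
    intro x
    rw [norm_overlapKernel_sub_eq_charSum hβ, hh]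
    dsimp only
    rw [mul_assoc]
    congr 1
    rw [mul_comm]
    congr 2
    fin_cases c
    · simp only [Fin.zero_eta, Fin.isValue, if_true]
      rw [← neg_sub x.2 y.2, tnorm_neg_eq]
    · simp only [Fin.mk_one, Fin.isValue, show (1 : Fin 2) ≠ 0 by decide, if_false]
  rw [Finset.sum_congr rfl fun x _ => hpt x, ← mul_sum]
  refine mul_le_mul_of_nonneg_left (le_of_eq ?_) hc0
  fin_cases c
  · simp only [Fin.zero_eta, Fin.isValue, if_true]
    exact sum_spaceTime_eq_sum_prodTorus_fst h y
  · simp only [Fin.mk_one, Fin.isValue, show (1 : Fin 2) ≠ 0 by decide, if_false]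
    exact sum_spaceTime_eq_sum_prodTorus h y

/-- **`(1 + Λ_T·tnorm)`-weighted column position sum of one defect kernel**: the same bound. [cite: BenfattoGiulianiMastropietro2006, §2.7 (2.71a)] -/
theorem colSumTn_overlapKernel_sub_le {β : ℝ} (hβ : 0 < β) (F'₁ F'₂ : Fin N' → FreqMomentum L M → ℂ) (F₁ F₂ : Fin N → FreqMomentum L M → ℂ)
    (ΛT : ℝ) (ω' : Fin N') (ω : Fin N) (σ c : Fin 2) (x : SpaceTimeIdx L M) :
    ∑ y : SpaceTimeIdx L M, ‖(sectorAnalysisMatrix L M β F'₁ * sectorSubMatrix L M β F₁ -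
        sectorAnalysisMatrix L M β F'₂ * sectorSubMatrix L M β F₂) (y, ((ω', σ), c)) (x, ((ω, σ), c))‖ *
        (1 + ΛT * (Torus.tnorm (y.2 - x.2) : ℝ)) ≤
      1 / (β * (L : ℝ) ^ 2) * ∑ z : TorusSite 1 (2 * M) × TorusSite 2 L,
        (1 + ΛT * (Torus.tnorm z.2 : ℝ)) *
          ‖∑ q : TorusSite 1 (2 * M) × TorusSite 2 L, (torusChar q.1 z.1 * torusChar q.2 z.2) •
            (F'₁ ω' (⟨(q.1 0).val, ZMod.val_lt (q.1 0)⟩, q.2) * F₁ ω (⟨(q.1 0).val, ZMod.val_lt (q.1 0)⟩, q.2) -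
              F'₂ ω' (⟨(q.1 0).val, ZMod.val_lt (q.1 0)⟩, q.2) * F₂ ω (⟨(q.1 0).val, ZMod.val_lt (q.1 0)⟩, q.2))‖ := by
  have hL : (0 : ℝ) < L := Nat.cast_pos.2 (Nat.pos_of_ne_zero (NeZero.ne L))
  have hc0 : 0 ≤ 1 / (β * (L : ℝ) ^ 2) := by positivity
  set h : TorusSite 1 (2 * M) × TorusSite 2 L → ℝ := fun z =>
    (1 + ΛT * (Torus.tnorm z.2 : ℝ)) *
      ‖∑ q : TorusSite 1 (2 * M) × TorusSite 2 L, (torusChar q.1 z.1 * torusChar q.2 z.2) •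
        (F'₁ ω' (⟨(q.1 0).val, ZMod.val_lt (q.1 0)⟩, q.2) * F₁ ω (⟨(q.1 0).val, ZMod.val_lt (q.1 0)⟩, q.2) -
          F'₂ ω' (⟨(q.1 0).val, ZMod.val_lt (q.1 0)⟩, q.2) * F₂ ω (⟨(q.1 0).val, ZMod.val_lt (q.1 0)⟩, q.2))‖ with hh
  have hpt : ∀ y : SpaceTimeIdx L M,
      ‖(sectorAnalysisMatrix L M β F'₁ * sectorSubMatrix L M β F₁ - sectorAnalysisMatrix L M β F'₂ * sectorSubMatrix L M β F₂)
          (y, ((ω', σ), c)) (x, ((ω, σ), c))‖ * (1 + ΛT * (Torus.tnorm (y.2 - x.2) : ℝ)) =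
        1 / (β * (L : ℝ) ^ 2) *
          h ((fun _ : Fin 1 => (((if c = 0 then x else y).1 : ℕ) : ZMod (2 * M)) - (((if c = 0 then y else x).1 : ℕ) : ZMod (2 * M))),
            (if c = 0 then x else y).2 - (if c = 0 then y else x).2) := by
    intro y
    rw [norm_overlapKernel_sub_eq_charSum hβ, hh]
    dsimp only
    rw [mul_assoc]
    congr 1
    rw [mul_comm]
    congr 2
    fin_cases c
    · simp only [Fin.zero_eta, Fin.isValue, if_true]
      rw [← neg_sub x.2 y.2, tnorm_neg_eq]
    · simp only [Fin.mk_one, Fin.isValue, show (1 : Fin 2) ≠ 0 by decide, if_false]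
  rw [Finset.sum_congr rfl fun y _ => hpt y, ← mul_sum]
  refine mul_le_mul_of_nonneg_left (le_of_eq ?_) hc0
  fin_cases c
  · simp only [Fin.zero_eta, Fin.isValue, if_true]
    exact sum_spaceTime_eq_sum_prodTorus h x
  · simp only [Fin.mk_one, Fin.isValue, show (1 : Fin 2) ≠ 0 by decide, if_false]
    exact sum_spaceTime_eq_sum_prodTorus_fst h x

/-! ### §2 Thin × fat differences from thin × thin differences, any weight -/

/-- **Weighted thin × fat DIFFERENCE from weighted thin × thin differences, ANY nonnegative weight**: if for every neighbour `a ∈ S_{ω₂}` the weighted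
`ℓ¹` character sum of `F^{K′}_{ω₁}F^{K′}_a − F^{K}_{ω₁}F^{K}_a` is `≤ T`, then that of `F^{K′}_{ω₁}F̃^{K′}_{ω₂} − F^{K}_{ω₁}F̃^{K}_{ω₂}` is `≤ 3T` (`n₂ + 1 ≤ n₁`).
[cite: BenfattoGiulianiMastropietro2006, §2.7 (2.66), (2.71a)] -/
theorem charSumW_klAniso_bgmFat_sub_le {e₀ : ℝ} (he : 0 < e₀) (β μ : ℝ) (K K' : TrigPolyC4v)
    (w : TorusSite 1 (2 * M) × TorusSite 2 L → ℝ) (hw0 : ∀ z, 0 ≤ w z)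
    {n₁ n₂ : ℕ} (hn : n₂ + 1 ≤ n₁) (ω₁ : Fin (sectorCount n₁)) (ω₂ : Fin (sectorCount n₂)) {T : ℝ} (hT0 : 0 ≤ T)
    (hT : ∀ a' : Fin (sectorCount n₂), ∑ z : TorusSite 1 (2 * M) × TorusSite 2 L, w z *
      ‖∑ q : TorusSite 1 (2 * M) × TorusSite 2 L, (torusChar q.1 z.1 * torusChar q.2 z.2) •
        (klAnisoFamily L M β μ K' e₀ n₁ ω₁ (⟨(q.1 0).val, ZMod.val_lt (q.1 0)⟩, q.2) *
            klAnisoFamily L M β μ K' e₀ n₂ a' (⟨(q.1 0).val, ZMod.val_lt (q.1 0)⟩, q.2) -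
          klAnisoFamily L M β μ K e₀ n₁ ω₁ (⟨(q.1 0).val, ZMod.val_lt (q.1 0)⟩, q.2) *
            klAnisoFamily L M β μ K e₀ n₂ a' (⟨(q.1 0).val, ZMod.val_lt (q.1 0)⟩, q.2))‖ ≤ T) :
    ∑ z : TorusSite 1 (2 * M) × TorusSite 2 L, w z *
      ‖∑ q : TorusSite 1 (2 * M) × TorusSite 2 L, (torusChar q.1 z.1 * torusChar q.2 z.2) •
        (klAnisoFamily L M β μ K' e₀ n₁ ω₁ (⟨(q.1 0).val, ZMod.val_lt (q.1 0)⟩, q.2) *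
            bgmFatMultiplier L M e₀ β (nambuXiCT L μ K') n₂ ω₂ (⟨(q.1 0).val, ZMod.val_lt (q.1 0)⟩, q.2) -
          klAnisoFamily L M β μ K e₀ n₁ ω₁ (⟨(q.1 0).val, ZMod.val_lt (q.1 0)⟩, q.2) *
            bgmFatMultiplier L M e₀ β (nambuXiCT L μ K) n₂ ω₂ (⟨(q.1 0).val, ZMod.val_lt (q.1 0)⟩, q.2))‖ ≤ 3 * T := by
  set S := (univ : Finset (Fin (sectorCount n₂))).filter (fun a' : Fin (sectorCount n₂) =>
      ∃ δ : ℤ, |δ| ≤ 1 ∧ (sectorCount n₂ : ℤ) ∣ (((a' : ℕ) : ℤ) - ((ω₂ : ℕ) : ℤ) - δ)) with hS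
  have hScard : S.card ≤ 3 := card_fatNbrFin_le_three n₂ (ω₂ : ℕ)
  have hsub : ∀ q : TorusSite 1 (2 * M) × TorusSite 2 L,
      klAnisoFamily L M β μ K' e₀ n₁ ω₁ (⟨(q.1 0).val, ZMod.val_lt (q.1 0)⟩, q.2) *
            bgmFatMultiplier L M e₀ β (nambuXiCT L μ K') n₂ ω₂ (⟨(q.1 0).val, ZMod.val_lt (q.1 0)⟩, q.2) -
          klAnisoFamily L M β μ K e₀ n₁ ω₁ (⟨(q.1 0).val, ZMod.val_lt (q.1 0)⟩, q.2) *
            bgmFatMultiplier L M e₀ β (nambuXiCT L μ K) n₂ ω₂ (⟨(q.1 0).val, ZMod.val_lt (q.1 0)⟩, q.2) =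
        ∑ a' ∈ S, (klAnisoFamily L M β μ K' e₀ n₁ ω₁ (⟨(q.1 0).val, ZMod.val_lt (q.1 0)⟩, q.2) *
            klAnisoFamily L M β μ K' e₀ n₂ a' (⟨(q.1 0).val, ZMod.val_lt (q.1 0)⟩, q.2) -
          klAnisoFamily L M β μ K e₀ n₁ ω₁ (⟨(q.1 0).val, ZMod.val_lt (q.1 0)⟩, q.2) *
            klAnisoFamily L M β μ K e₀ n₂ a' (⟨(q.1 0).val, ZMod.val_lt (q.1 0)⟩, q.2)) := by
    intro q
    rw [klAnisoFamily_mul_bgmFatMultiplier_eq_sum he β μ K' hn ω₁ ω₂, klAnisoFamily_mul_bgmFatMultiplier_eq_sum he β μ K hn ω₁ ω₂,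
      ← Finset.sum_sub_distrib]
  simp_rw [hsub]
  refine (sum_wt_norm_charSum_sum_le S _ hw0 (fun a' q =>
    klAnisoFamily L M β μ K' e₀ n₁ ω₁ (⟨(q.1 0).val, ZMod.val_lt (q.1 0)⟩, q.2) * klAnisoFamily L M β μ K' e₀ n₂ a' (⟨(q.1 0).val, ZMod.val_lt (q.1 0)⟩, q.2) -
      klAnisoFamily L M β μ K e₀ n₁ ω₁ (⟨(q.1 0).val, ZMod.val_lt (q.1 0)⟩, q.2) *
        klAnisoFamily L M β μ K e₀ n₂ a' (⟨(q.1 0).val, ZMod.val_lt (q.1 0)⟩, q.2))).trans ?_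
  calc _ ≤ ∑ _a ∈ S, T := Finset.sum_le_sum fun a' _ => hT a'
    _ = S.card * T := by rw [Finset.sum_const, nsmul_eq_mul]
    _ ≤ 3 * T := mul_le_mul_of_nonneg_right (by exact_mod_cast hScard) hT0

/-! ### §3 The re-analysis increment in the `Λ_T`-currency -/

/-- **Rate currency ⇒ `Λ_T`-currency, pointwise**: `(1 + Λ_T·tnorm z⃗₂)·g ≤ D_w·(1 + s₀|z̃₁| + s₁|z̃₂⁰| + s₁|z̃₂¹|)·g` for `g ≥ 0`, `1 ≤ D_w`, `0 ≤ Λ_T ≤ D_w s₁`,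
`0 ≤ s₀`. [folklore] -/
theorem sum_tnormWt_le_of_rates {P : ℕ} [NeZero P] {s₀ s₁ ΛT Dw : ℝ} (hs₀ : 0 ≤ s₀) (hDw : 1 ≤ Dw) (hΛT : 0 ≤ ΛT) (hdom : ΛT ≤ Dw * s₁)
    (g : TorusSite 1 P × TorusSite 2 L → ℝ) (hg : ∀ z, 0 ≤ g z) :
    ∑ z : TorusSite 1 P × TorusSite 2 L, (1 + ΛT * (Torus.tnorm z.2 : ℝ)) * g z ≤
      Dw * ∑ z : TorusSite 1 P × TorusSite 2 L,
        (1 + s₀ * |(((z.1 0).valMinAbs : ℤ) : ℝ)| + s₁ * |(((z.2 0).valMinAbs : ℤ) : ℝ)| + s₁ * |(((z.2 1).valMinAbs : ℤ) : ℝ)|) * g z := by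
  rw [Finset.mul_sum]
  refine Finset.sum_le_sum fun z _ => ?_
  rw [← mul_assoc]
  refine mul_le_mul_of_nonneg_right ?_ (hg z)
  have h1 := one_add_mul_tnorm_le_mul_rateWt hDw hΛT hdom z.2
  have h2 : 0 ≤ Dw * (s₀ * |(((z.1 0).valMinAbs : ℤ) : ℝ)|) := mul_nonneg (zero_le_one.trans hDw) (mul_nonneg hs₀ (abs_nonneg _))
  nlinarith only [h1, h2]

/-- **`(1 + Λ_T·tnorm)`-weighted ROWS of the re-analysis increment from a uniform bound at rates `(s₀, s₁)` with `Λ_T ≤ D_w·s₁`** (see the module docstring).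
[cite: BenfattoGiulianiMastropietro2006, §2.7 (2.71)–(2.71a), §3 (3.3)] -/
theorem rowSumTn_klReanalysis_sub_le_of_rates {β : ℝ} (hβ : 0 < β) (μ : ℝ) (K K' : TrigPolyC4v) (k : ℕ) {T s₀ s₁ ΛT Dw : ℝ} (hT0 : 0 ≤ T)
    (hs₀ : 0 ≤ s₀) (hDw : 1 ≤ Dw) (hΛT : 0 ≤ ΛT) (hdom : ΛT ≤ Dw * s₁)
    (hT : ∀ (ω₁ : Fin (sectorCount (k + 1))) (a' : Fin (sectorCount k)), ∑ z : TorusSite 1 (2 * M) × TorusSite 2 L,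
      (1 + s₀ * |(((z.1 0).valMinAbs : ℤ) : ℝ)| + s₁ * |(((z.2 0).valMinAbs : ℤ) : ℝ)| + s₁ * |(((z.2 1).valMinAbs : ℤ) : ℝ)|) *
      ‖∑ q : TorusSite 1 (2 * M) × TorusSite 2 L, (torusChar q.1 z.1 * torusChar q.2 z.2) •
        (klAnisoFamily L M β μ K' klE0 (k + 1) ω₁ (⟨(q.1 0).val, ZMod.val_lt (q.1 0)⟩, q.2) *
            klAnisoFamily L M β μ K' klE0 k a' (⟨(q.1 0).val, ZMod.val_lt (q.1 0)⟩, q.2) -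
          klAnisoFamily L M β μ K klE0 (k + 1) ω₁ (⟨(q.1 0).val, ZMod.val_lt (q.1 0)⟩, q.2) *
            klAnisoFamily L M β μ K klE0 k a' (⟨(q.1 0).val, ZMod.val_lt (q.1 0)⟩, q.2))‖ ≤ T)
    (X'' : SpaceTimeIdx L M × SectorLeg (sectorCount (k + 1))) :
    ∑ X' : SpaceTimeIdx L M × SectorLeg (sectorCount k), ‖(klReanalysis L M β μ K' k - klReanalysis L M β μ K k) X'' X'‖ *
        (1 + ΛT * (Torus.tnorm (X''.1.2 - X'.1.2) : ℝ)) ≤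
      imagTimeWeight β M * (((27 : ℕ) + (27 : ℕ)) * (3 * (Dw * T) / (β * (L : ℝ) ^ 2))) := by
  have he : (0 : ℝ) < klE0 := by norm_num [klE0]
  have hL : (0 : ℝ) < L := Nat.cast_pos.2 (Nat.pos_of_ne_zero (NeZero.ne L))
  have hε : 0 ≤ imagTimeWeight β M := imagTimeWeight_nonneg hβ.le M
  have hk : k + 1 ≤ k + 1 := le_rfl
  have hDw0 : 0 ≤ Dw := zero_le_one.trans hDw
  have hw0 : ∀ z : TorusSite 1 (2 * M) × TorusSite 2 L, 0 ≤ 1 + ΛT * (Torus.tnorm z.2 : ℝ) := fun z => by positivity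
  -- the thin-pair differences in the `Λ_T`-currency: `≤ D_w·T`
  have hT' : ∀ (ω₁ : Fin (sectorCount (k + 1))) (a' : Fin (sectorCount k)), ∑ z : TorusSite 1 (2 * M) × TorusSite 2 L,
      (1 + ΛT * (Torus.tnorm z.2 : ℝ)) *
      ‖∑ q : TorusSite 1 (2 * M) × TorusSite 2 L, (torusChar q.1 z.1 * torusChar q.2 z.2) •
        (klAnisoFamily L M β μ K' klE0 (k + 1) ω₁ (⟨(q.1 0).val, ZMod.val_lt (q.1 0)⟩, q.2) *
            klAnisoFamily L M β μ K' klE0 k a' (⟨(q.1 0).val, ZMod.val_lt (q.1 0)⟩, q.2) -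
          klAnisoFamily L M β μ K klE0 (k + 1) ω₁ (⟨(q.1 0).val, ZMod.val_lt (q.1 0)⟩, q.2) *
            klAnisoFamily L M β μ K klE0 k a' (⟨(q.1 0).val, ZMod.val_lt (q.1 0)⟩, q.2))‖ ≤ Dw * T := fun ω₁ a' =>
    (sum_tnormWt_le_of_rates hs₀ hDw hΛT hdom _ (fun z => norm_nonneg _)).trans (mul_le_mul_of_nonneg_left (hT ω₁ a') hDw0)
  -- the increment matrix is `ε •` the difference of the two product kernels
  set A : Matrix (SpaceTimeIdx L M × SectorLeg (sectorCount (k + 1))) (SpaceTimeIdx L M × SectorLeg (sectorCount k)) ℂ :=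
    sectorAnalysisMatrix L M β (klAnisoFamily L M β μ K' klE0 (k + 1)) * sectorSubMatrix L M β (bgmFatMultiplier L M klE0 β (nambuXiCT L μ K') k) -
      sectorAnalysisMatrix L M β (klAnisoFamily L M β μ K klE0 (k + 1)) * sectorSubMatrix L M β (bgmFatMultiplier L M klE0 β (nambuXiCT L μ K) k)
    with hAdef
  have hentry : ∀ X', ‖(klReanalysis L M β μ K' k - klReanalysis L M β μ K k) X'' X'‖ = imagTimeWeight β M * ‖A X'' X'‖ := by
    intro X'
    rw [Matrix.sub_apply, klReanalysis_eq_smul, klReanalysis_eq_smul, Matrix.smul_apply, Matrix.smul_apply, smul_eq_mul, smul_eq_mul, ← mul_sub,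
      norm_mul, Complex.norm_real, Real.norm_eq_abs, abs_of_nonneg hε, hAdef, Matrix.sub_apply]
  simp_rw [hentry, mul_assoc, ← Finset.mul_sum]
  refine mul_le_mul_of_nonneg_left ?_ hε
  -- one difference block
  have hblock : ∀ (ω' : Fin (sectorCount (k + 1))) (ω : Fin (sectorCount k)) (σ c : Fin 2) (y : SpaceTimeIdx L M),
      ∑ x : SpaceTimeIdx L M, ‖A (y, ((ω', σ), c)) (x, ((ω, σ), c))‖ * (1 + ΛT * (Torus.tnorm (y.2 - x.2) : ℝ)) ≤ 3 * (Dw * T) / (β * (L : ℝ) ^ 2) := by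
    intro ω' ω σ c y
    refine (rowSumTn_overlapKernel_sub_le hβ _ _ _ _ ΛT ω' ω σ c y).trans ?_
    rw [div_eq_mul_one_div (3 * (Dw * T)) (β * (L : ℝ) ^ 2), mul_comm (3 * (Dw * T))]
    exact mul_le_mul_of_nonneg_left (charSumW_klAniso_bgmFat_sub_le he β μ K K' _ hw0 hk ω' ω (mul_nonneg hDw0 hT0) (hT' ω')) (by positivity)
  have h := rowSum_wt_overlapKernel_sub_le β _ _ _ _
    (fun ω₁ => card_jointOverlap_le _ _ _ _ ω₁ (card_overlap_klAniso_bgmFat_coarse_le he β μ K' (Nat.le_succ k) ω₁)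
      (card_overlap_klAniso_bgmFat_coarse_le he β μ K (Nat.le_succ k) ω₁))
    (fun Y' Y => 1 + ΛT * (Torus.tnorm (Y'.1.2 - Y.1.2) : ℝ)) (by positivity) hblock X''
  simpa only [hAdef, Nat.cast_add] using h

/-- **`(1 + Λ_T·tnorm)`-weighted COLUMNS of the re-analysis increment from a uniform bound at rates `(s₀, s₁)` with `Λ_T ≤ D_w·s₁`**.
[cite: BenfattoGiulianiMastropietro2006, §2.7 (2.71)–(2.71a), §3 (3.3)] -/
theorem colSumTn_klReanalysis_sub_le_of_rates {β : ℝ} (hβ : 0 < β) (μ : ℝ) (K K' : TrigPolyC4v) (k : ℕ) {T s₀ s₁ ΛT Dw : ℝ} (hT0 : 0 ≤ T)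
    (hs₀ : 0 ≤ s₀) (hDw : 1 ≤ Dw) (hΛT : 0 ≤ ΛT) (hdom : ΛT ≤ Dw * s₁)
    (hT : ∀ (ω₁ : Fin (sectorCount (k + 1))) (a' : Fin (sectorCount k)), ∑ z : TorusSite 1 (2 * M) × TorusSite 2 L,
      (1 + s₀ * |(((z.1 0).valMinAbs : ℤ) : ℝ)| + s₁ * |(((z.2 0).valMinAbs : ℤ) : ℝ)| + s₁ * |(((z.2 1).valMinAbs : ℤ) : ℝ)|) *
      ‖∑ q : TorusSite 1 (2 * M) × TorusSite 2 L, (torusChar q.1 z.1 * torusChar q.2 z.2) •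
        (klAnisoFamily L M β μ K' klE0 (k + 1) ω₁ (⟨(q.1 0).val, ZMod.val_lt (q.1 0)⟩, q.2) *
            klAnisoFamily L M β μ K' klE0 k a' (⟨(q.1 0).val, ZMod.val_lt (q.1 0)⟩, q.2) -
          klAnisoFamily L M β μ K klE0 (k + 1) ω₁ (⟨(q.1 0).val, ZMod.val_lt (q.1 0)⟩, q.2) *
            klAnisoFamily L M β μ K klE0 k a' (⟨(q.1 0).val, ZMod.val_lt (q.1 0)⟩, q.2))‖ ≤ T)
    (X' : SpaceTimeIdx L M × SectorLeg (sectorCount k)) :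
    ∑ X'' : SpaceTimeIdx L M × SectorLeg (sectorCount (k + 1)), ‖(klReanalysis L M β μ K' k - klReanalysis L M β μ K k) X'' X'‖ *
        (1 + ΛT * (Torus.tnorm (X''.1.2 - X'.1.2) : ℝ)) ≤
      imagTimeWeight β M * (((27 * 2 ^ (k + 1 - k) : ℕ) + (27 * 2 ^ (k + 1 - k) : ℕ)) * (3 * (Dw * T) / (β * (L : ℝ) ^ 2))) := by
  have he : (0 : ℝ) < klE0 := by norm_num [klE0]
  have hL : (0 : ℝ) < L := Nat.cast_pos.2 (Nat.pos_of_ne_zero (NeZero.ne L))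
  have hε : 0 ≤ imagTimeWeight β M := imagTimeWeight_nonneg hβ.le M
  have hk : k + 1 ≤ k + 1 := le_rfl
  have hDw0 : 0 ≤ Dw := zero_le_one.trans hDw
  have hw0 : ∀ z : TorusSite 1 (2 * M) × TorusSite 2 L, 0 ≤ 1 + ΛT * (Torus.tnorm z.2 : ℝ) := fun z => by positivity
  have hT' : ∀ (ω₁ : Fin (sectorCount (k + 1))) (a' : Fin (sectorCount k)), ∑ z : TorusSite 1 (2 * M) × TorusSite 2 L,
      (1 + ΛT * (Torus.tnorm z.2 : ℝ)) *
      ‖∑ q : TorusSite 1 (2 * M) × TorusSite 2 L, (torusChar q.1 z.1 * torusChar q.2 z.2) •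
        (klAnisoFamily L M β μ K' klE0 (k + 1) ω₁ (⟨(q.1 0).val, ZMod.val_lt (q.1 0)⟩, q.2) *
            klAnisoFamily L M β μ K' klE0 k a' (⟨(q.1 0).val, ZMod.val_lt (q.1 0)⟩, q.2) -
          klAnisoFamily L M β μ K klE0 (k + 1) ω₁ (⟨(q.1 0).val, ZMod.val_lt (q.1 0)⟩, q.2) *
            klAnisoFamily L M β μ K klE0 k a' (⟨(q.1 0).val, ZMod.val_lt (q.1 0)⟩, q.2))‖ ≤ Dw * T := fun ω₁ a' =>
    (sum_tnormWt_le_of_rates hs₀ hDw hΛT hdom _ (fun z => norm_nonneg _)).trans (mul_le_mul_of_nonneg_left (hT ω₁ a') hDw0)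
  set A : Matrix (SpaceTimeIdx L M × SectorLeg (sectorCount (k + 1))) (SpaceTimeIdx L M × SectorLeg (sectorCount k)) ℂ :=
    sectorAnalysisMatrix L M β (klAnisoFamily L M β μ K' klE0 (k + 1)) * sectorSubMatrix L M β (bgmFatMultiplier L M klE0 β (nambuXiCT L μ K') k) -
      sectorAnalysisMatrix L M β (klAnisoFamily L M β μ K klE0 (k + 1)) * sectorSubMatrix L M β (bgmFatMultiplier L M klE0 β (nambuXiCT L μ K) k)
    with hAdef
  have hentry : ∀ X'', ‖(klReanalysis L M β μ K' k - klReanalysis L M β μ K k) X'' X'‖ = imagTimeWeight β M * ‖A X'' X'‖ := by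
    intro X''
    rw [Matrix.sub_apply, klReanalysis_eq_smul, klReanalysis_eq_smul, Matrix.smul_apply, Matrix.smul_apply, smul_eq_mul, smul_eq_mul, ← mul_sub,
      norm_mul, Complex.norm_real, Real.norm_eq_abs, abs_of_nonneg hε, hAdef, Matrix.sub_apply]
  simp_rw [hentry, mul_assoc, ← Finset.mul_sum]
  refine mul_le_mul_of_nonneg_left ?_ hε
  have hblock : ∀ (ω' : Fin (sectorCount (k + 1))) (ω : Fin (sectorCount k)) (σ c : Fin 2) (x : SpaceTimeIdx L M),
      ∑ y : SpaceTimeIdx L M, ‖A (y, ((ω', σ), c)) (x, ((ω, σ), c))‖ * (1 + ΛT * (Torus.tnorm (y.2 - x.2) : ℝ)) ≤ 3 * (Dw * T) / (β * (L : ℝ) ^ 2) := by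
    intro ω' ω σ c x
    refine (colSumTn_overlapKernel_sub_le hβ _ _ _ _ ΛT ω' ω σ c x).trans ?_
    rw [div_eq_mul_one_div (3 * (Dw * T)) (β * (L : ℝ) ^ 2), mul_comm (3 * (Dw * T))]
    exact mul_le_mul_of_nonneg_left (charSumW_klAniso_bgmFat_sub_le he β μ K K' _ hw0 hk ω' ω (mul_nonneg hDw0 hT0) (hT' ω')) (by positivity)
  have h := colSum_wt_overlapKernel_sub_le β _ _ _ _
    (fun ω₂ => card_jointOverlap_le' _ _ _ _ ω₂ (card_overlap_klAniso_bgmFat_fine_le he β μ K' (Nat.le_succ k) ω₂)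
      (card_overlap_klAniso_bgmFat_fine_le he β μ K (Nat.le_succ k) ω₂))
    (fun Y' Y => 1 + ΛT * (Torus.tnorm (Y'.1.2 - Y.1.2) : ℝ)) (by positivity) hblock X'
  simpa only [hAdef, Nat.cast_add] using h

end Summit.HubbardSuperconductivity.HubbardSuperconductivity.Theorems.TorusFourierL2

end
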